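import Mathlib.Data.Fin.Tuple.Basic
import Mathlib.Algebra.BigOperators.Fin
import Mathlib.Algebra.Order.BigOperators.Group.Finset
import Mathlib.Tactic.Linarith
import Mathlib.Tactic.Ring
import HarnessLib

/-!
# The comb (top tensor-Bernstein) form of the `F`-inequality: the sectioning step at a coordinate without doubly-pivotal
# antipodal pairs

Support file (cell `prim-bnk`, seat bnk-2 gen 20; `--supports stmt-CriticalPhenomena-4575`; memo
`run/shared/lean/prim/prim-l12/FROM-prim-bnk-2-g20-CP-CERTIFICATES.md`, Theorem 2 / Π-step).  No definition, no `sorry`,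
standard axioms.

Setting.  Events on the cube `Fin n → Bool` are encoded by their indicator functions `A B G : (Fin n → Bool) → Bool`
(an event is *increasing along a coordinate* when flipping that coordinate from `false` to `true` cannot leave it).  The
antipode of `x` is `fun i => !x i`.  For increasing `A, B, G` the top tensor-Bernstein coefficient of
`F(A,B;G) = (1+μG)μ(ABG) − μG·μ(AB) − μ(AG)μ(BG)` (the conjectured master-family inequality of `prim-master-conj`, kernel
`SahiFInduction.F_bernstein_secAt` for the one-coordinate form) is the integer

  `K(A,B,G) = #{x ∈ ABG} − #{x ∈ AG : x̄ ∈ BG} − #{x ∈ G : x̄ ∈ AB ∖ G}`,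

written below as the sum over the cube of the pointwise integrand `[x∈ABG] − [x∈AG ∧ x̄∈BG] − [x∈G ∧ x̄∈AB∖G]` (spelled out with `Bool.toNat`).  Nonnegativity of `K` for all up-sets in all
dimensions (on a restriction-closed class of third events `G`) gives nonnegativity of every tensor-Bernstein coefficient of
`F`, hence `F ≥ 0` for every product measure, for that class.

THIS FILE PROVES the engine of the recursion found in gen 20 (memo, Theorem 2 specialised to the full pair system):

**THEOREM (`comb_sum_ge_sections`).**  Fix a coordinate `e`.  If `A, B, G` are increasing along `e` and `G` has NO antipodal
pair of the `e = true` facet at which `e` is doubly pivotal (i.e. there is no `y` with `e` pivotal for `G` both at `y` and at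
the facet-antipode `ȳ`), then `K(A,B,G) ≥ K(A⁰,B⁰,G⁰) + K(A¹,B¹,G¹)`, where `X^t` is the section `y ↦ X(insertNth e t y)`.

The proof is the memo's identity `K − K⁰ − K¹ = Σ 2sym(v_x v_{x̄}) + Σ_y c_y(…)` collapsed to a pointwise statement: after
splitting the cube along `e` and pairing `y` with its antipode, the difference is a sum over `y` of a quantity whose
symmetrisation `Ψ(y) + Ψ(ȳ)` is a nonnegative function of the twelve relevant memberships (`comb_pair_nonneg`, a finite check).
Together with the trivial base case in dimension `0` (`comb_sum_nonneg_zero`) this yields `K ≥ 0` for every third event that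
can be peeled recursively along such coordinates — in particular (memo, Lemma B: a leaf with a leaf sibling of a read-once
formula is never doubly pivotal on an antipodal pair) for every READ-ONCE `G`; the recursive class and the read-once corollary
are assembled in a companion file.  HONEST FRAMING: a reusable inequality for one sectioning step; `F ≥ 0` in general remains
OPEN. [this work]
-/

namespace Summit.CriticalPhenomena.PercolationContinuityZ3.Theorems

namespace SahiFComb

open Finset

variable {n : ℕ}

/-! ### 1. The finite check behind the step -/

set_option synthInstance.maxSize 100000 in
set_option synthInstance.maxHeartbeats 200000 in
/-- The twelve-Boolean inequality behind the sectioning step: for memberships of the four points `y0 ≤ y1` (values `a0,a1,…`)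
and `ȳ0 ≤ ȳ1` (values `a0',a1',…`) in events increasing along the split coordinate, and without a doubly-pivotal antipodal
pair for `G`, the four integrands of the big cube dominate the four integrands of the two sections. [this work] -/
theorem comb_pair_nonneg (a0 a1 b0 b1 g0 g1 : Bool) :
    ∀ (a0' a1' b0' b1' g0' g1' : Bool),
      (a0 = true → a1 = true) → (b0 = true → b1 = true) → (g0 = true → g1 = true) →
      (a0' = true → a1' = true) → (b0' = true → b1' = true) → (g0' = true → g1' = true) →
      ¬ (g1 = true ∧ g0 = false ∧ g1' = true ∧ g0' = false) →
      0 ≤ ( (((Bool.toNat (a1 && b1 && g1) : ℕ) : ℤ) - ((Bool.toNat (a1 && g1 && b0' && g0') : ℕ) : ℤ) - ((Bool.toNat (g1 && a0' && b0' && !g0') : ℕ) : ℤ))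
            + (((Bool.toNat (a0 && b0 && g0) : ℕ) : ℤ) - ((Bool.toNat (a0 && g0 && b1' && g1') : ℕ) : ℤ) - ((Bool.toNat (g0 && a1' && b1' && !g1') : ℕ) : ℤ))
            + (((Bool.toNat (a1' && b1' && g1') : ℕ) : ℤ) - ((Bool.toNat (a1' && g1' && b0 && g0) : ℕ) : ℤ) - ((Bool.toNat (g1' && a0 && b0 && !g0) : ℕ) : ℤ))
            + (((Bool.toNat (a0' && b0' && g0') : ℕ) : ℤ) - ((Bool.toNat (a0' && g0' && b1 && g1) : ℕ) : ℤ) - ((Bool.toNat (g0' && a1 && b1 && !g1) : ℕ) : ℤ)) )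
          - ( (((Bool.toNat (a0 && b0 && g0) : ℕ) : ℤ) - ((Bool.toNat (a0 && g0 && b0' && g0') : ℕ) : ℤ) - ((Bool.toNat (g0 && a0' && b0' && !g0') : ℕ) : ℤ))
            + (((Bool.toNat (a0' && b0' && g0') : ℕ) : ℤ) - ((Bool.toNat (a0' && g0' && b0 && g0) : ℕ) : ℤ) - ((Bool.toNat (g0' && a0 && b0 && !g0) : ℕ) : ℤ))
            + (((Bool.toNat (a1 && b1 && g1) : ℕ) : ℤ) - ((Bool.toNat (a1 && g1 && b1' && g1') : ℕ) : ℤ) - ((Bool.toNat (g1 && a1' && b1' && !g1') : ℕ) : ℤ))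
            + (((Bool.toNat (a1' && b1' && g1') : ℕ) : ℤ) - ((Bool.toNat (a1' && g1' && b1 && g1) : ℕ) : ℤ) - ((Bool.toNat (g1' && a1 && b1 && !g1) : ℕ) : ℤ)) ) := by
  revert a0 a1 b0 b1 g0 g1
  decide +kernel

/-! ### 2. Plumbing: splitting the cube along a coordinate, antipodes of inserted tuples -/

/-- The antipode of `insertNth e t y` is `insertNth e (!t) ȳ`. [folklore] -/
theorem antipode_insertNth (e : Fin (n + 1)) (t : Bool) (y : Fin n → Bool) :
    (fun i => !(Fin.insertNth (α := fun _ => Bool) e t y i)) =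
      Fin.insertNth (α := fun _ => Bool) e (!t) (fun j => !y j) := by
  funext i
  refine Fin.succAboveCases e ?_ (fun j => ?_) i
  · simp [Fin.insertNth_apply_same]
  · simp [Fin.insertNth_apply_succAbove]

/-- Splitting a sum over the `(n+1)`-cube along the coordinate `e`. [folklore] -/
theorem sum_cube_split (e : Fin (n + 1)) (f : (Fin (n + 1) → Bool) → ℤ) :
    ∑ x : Fin (n + 1) → Bool, f x =
      ∑ y : Fin n → Bool, (f (Fin.insertNth e false y) + f (Fin.insertNth e true y)) := by
  rw [← Fintype.sum_equiv (Fin.insertNthEquiv (fun _ => Bool) e) (fun p => f (Fin.insertNth e p.1 p.2)) f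
    (fun p => rfl)]
  rw [Fintype.sum_prod_type, Fintype.sum_bool]
  rw [← Finset.sum_add_distrib]
  exact Finset.sum_congr rfl (fun y _ => add_comm _ _)

/-- Re-indexing a sum over the cube by the antipode. [folklore] -/
theorem sum_antipode (f : (Fin n → Bool) → ℤ) :
    ∑ y : Fin n → Bool, f (fun j => !y j) = ∑ y : Fin n → Bool, f y := by
  refine Fintype.sum_equiv ⟨fun y j => !y j, fun y j => !y j, fun y => ?_, fun y => ?_⟩ _ _ (fun y => rfl)
  · funext j; simp
  · funext j; simp

/-- A sum is nonnegative as soon as its symmetrisation under the antipode is pointwise nonnegative. [folklore] -/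
theorem sum_nonneg_of_pair_nonneg (f : (Fin n → Bool) → ℤ)
    (h : ∀ y : Fin n → Bool, 0 ≤ f y + f (fun j => !y j)) : 0 ≤ ∑ y : Fin n → Bool, f y := by
  have h2 : 2 * ∑ y : Fin n → Bool, f y = ∑ y : Fin n → Bool, (f y + f (fun j => !y j)) := by
    rw [Finset.sum_add_distrib, sum_antipode, two_mul]
  have h3 : 0 ≤ ∑ y : Fin n → Bool, (f y + f (fun j => !y j)) := Finset.sum_nonneg (fun y _ => h y)
  linarith

/-! ### 3. The sectioning step -/

/-- **Π-step of the comb recursion.**  Let `A, B, G : (Fin (n+1) → Bool) → Bool` be increasing along the coordinate `e`, and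
assume `G` has no doubly-pivotal antipodal pair along `e` (no `y` with `e` pivotal for `G` at `insertNth e · y` and at
`insertNth e · ȳ`).  Then the comb form of the big cube dominates the sum of the comb forms of the two `e`-sections:
`K(A,B,G) ≥ K(A⁰,B⁰,G⁰) + K(A¹,B¹,G¹)`. [this work] -/
theorem comb_sum_ge_sections (e : Fin (n + 1)) (A B G : (Fin (n + 1) → Bool) → Bool)
    (hA : ∀ y, A (Fin.insertNth e false y) = true → A (Fin.insertNth e true y) = true)
    (hB : ∀ y, B (Fin.insertNth e false y) = true → B (Fin.insertNth e true y) = true)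
    (hG : ∀ y, G (Fin.insertNth e false y) = true → G (Fin.insertNth e true y) = true)
    (hPi : ∀ y, ¬ (G (Fin.insertNth e true y) = true ∧ G (Fin.insertNth e false y) = false ∧
                   G (Fin.insertNth e true (fun j => !y j)) = true ∧ G (Fin.insertNth e false (fun j => !y j)) = false)) :
    (∑ y : Fin n → Bool, (((Bool.toNat (A (Fin.insertNth e false y) && B (Fin.insertNth e false y) && G (Fin.insertNth e false y)) : ℕ) : ℤ) - ((Bool.toNat (A (Fin.insertNth e false y) && G (Fin.insertNth e false y) && B (Fin.insertNth e false (fun j => !y j)) && G (Fin.insertNth e false (fun j => !y j))) : ℕ) : ℤ) - ((Bool.toNat (G (Fin.insertNth e false y) && A (Fin.insertNth e false (fun j => !y j)) && B (Fin.insertNth e false (fun j => !y j)) && !(G (Fin.insertNth e false (fun j => !y j)))) : ℕ) : ℤ)))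
    + (∑ y : Fin n → Bool, (((Bool.toNat (A (Fin.insertNth e true y) && B (Fin.insertNth e true y) && G (Fin.insertNth e true y)) : ℕ) : ℤ) - ((Bool.toNat (A (Fin.insertNth e true y) && G (Fin.insertNth e true y) && B (Fin.insertNth e true (fun j => !y j)) && G (Fin.insertNth e true (fun j => !y j))) : ℕ) : ℤ) - ((Bool.toNat (G (Fin.insertNth e true y) && A (Fin.insertNth e true (fun j => !y j)) && B (Fin.insertNth e true (fun j => !y j)) && !(G (Fin.insertNth e true (fun j => !y j)))) : ℕ) : ℤ)))
    ≤ ∑ x : Fin (n + 1) → Bool, (((Bool.toNat (A x && B x && G x) : ℕ) : ℤ) - ((Bool.toNat (A x && G x && B (fun i => !x i) && G (fun i => !x i)) : ℕ) : ℤ) - ((Bool.toNat (G x && A (fun i => !x i) && B (fun i => !x i) && !(G (fun i => !x i))) : ℕ) : ℤ)) := by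
  rw [sum_cube_split e]
  -- antipodes of inserted tuples
  have h0 : ∀ y : Fin n → Bool, (fun i => !(Fin.insertNth (α := fun _ => Bool) e false y i)) =
      Fin.insertNth (α := fun _ => Bool) e true (fun j => !y j) :=
    fun y => by simpa using antipode_insertNth e false y
  have h1 : ∀ y : Fin n → Bool, (fun i => !(Fin.insertNth (α := fun _ => Bool) e true y i)) =
      Fin.insertNth (α := fun _ => Bool) e false (fun j => !y j) :=
    fun y => by simpa using antipode_insertNth e true y
  simp only [h0, h1]
  rw [← sub_nonneg, ← Finset.sum_add_distrib, ← Finset.sum_sub_distrib]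
  refine sum_nonneg_of_pair_nonneg _ (fun y => ?_)
  have hyy : (fun j => !(fun j => !y j) j) = y := by funext j; simp
  simp only [hyy]
  have key := comb_pair_nonneg
    (A (Fin.insertNth e false y)) (A (Fin.insertNth e true y)) (B (Fin.insertNth e false y)) (B (Fin.insertNth e true y))
    (G (Fin.insertNth e false y)) (G (Fin.insertNth e true y))
    (A (Fin.insertNth e false (fun j => !y j))) (A (Fin.insertNth e true (fun j => !y j)))
    (B (Fin.insertNth e false (fun j => !y j))) (B (Fin.insertNth e true (fun j => !y j)))
    (G (Fin.insertNth e false (fun j => !y j))) (G (Fin.insertNth e true (fun j => !y j)))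
    (hA y) (hB y) (hG y) (hA _) (hB _) (hG _) (hPi y)
  linarith [key]

/-! ### 4. The base case -/

/-- In dimension `0` the comb form vanishes (the unique point is its own antipode). [this work] -/
theorem comb_sum_nonneg_zero (A B G : (Fin 0 → Bool) → Bool) :
    0 ≤ ∑ x : Fin 0 → Bool, (((Bool.toNat (A x && B x && G x) : ℕ) : ℤ) - ((Bool.toNat (A x && G x && B (fun i => !x i) && G (fun i => !x i)) : ℕ) : ℤ) - ((Bool.toNat (G x && A (fun i => !x i) && B (fun i => !x i) && !(G (fun i => !x i))) : ℕ) : ℤ)) := by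
  refine Finset.sum_nonneg (fun x _ => ?_)
  have hx : (fun i => !x i) = x := by funext i; exact Fin.elim0 i
  rw [hx]
  cases A x <;> cases B x <;> cases G x <;> decide

end SahiFComb

end Summit.CriticalPhenomena.PercolationContinuityZ3.Theorems
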